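import Summits.ValiantsHypothesis.ValiantsHypothesis.Theorems.GrenetZeonDualUnipotentThreeHalvesHeavyTopKrylovSeed
import Summits.ValiantsHypothesis.ValiantsHypothesis.Theorems.GrenetZeonDualUnipotentThreeHalvesHeavyTopIndexCore

/-!
# `GrenetZeon.DualUnipotentThreeHalves` (stmt-ValiantsHypothesis-24318), R2 `HeavyTopLaw` / LINE α `krylov_seed`: NIL-CORES are WEIGHT
# certificates (α's own currency `WeightThin`), the typed candidate law `NilCoreLaw`, and `NilCoreLaw ⇒ IndexCoreLaw`

Port (val-lit merged desk, b71 (B) port pool; porter val-port-2 g3, 24318 line α lead; critic of record val-idea-crit-7 g2 VERDICT #16/16a: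
card #10 `nil-core` KEEP — PASS; price P10-3 «no objection in principle») of §1–§2 of val-idea-26 g3's sorry-free crux workfile
`Cruxes/DualUnipotentThreeHalves/NilCore.lean` @4763c601f003 plus its two bridge lemmas to the index-core block (whose §3 is ✓ p670964
`…HeavyTopIndexCore`), VERBATIM by name; crux workfiles are not importable from `Theorems/`, hence the re-landing.  Texts and proofs are
val-idea-26 g3's.  This is the one typed sub-case law of record that lands INSIDE line α's currency: with ★ it gives `WeightThin` — the
conclusion of α's research stub S1b `FatBlockWeightLaw` (≡ C⁺ `UniformWeightLaw`, ✓ `…HeavyTopBlockMass`) — on the IRREDUCIBLE locus.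

A NIL-CORE of a space of matrices `W` is a subspace `T ≤ W` all of whose `ℓ`-fold products vanish (`IsNilCore T ℓ`; equivalently the
associative algebra generated by `T` is nilpotent of class `≤ ℓ`; equivalently — Levitzki/Radjavi — every WORD in elements of `T` is
traceless).  Its descending orbit chain `ℂ^m = F₀ ⊇ F₁ = T•F₀ ⊇ … ⊇ F_ℓ = 0` (`coreFlag`) is a WEIGHT FLAG in the sense of ✓ `WeightThin` with
`p = ℓ` levels, climb `c = 1` on `K = N_lin⁻¹(T)` and FREE drop `r = ℓ − 1`, so

  `((ℓ−1)·n/ℓ + 1)·n < dim K  ⟹  WeightThin n m N`      (★ `weightThin_of_nilCore`)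

i.e. a nil-core of class `ℓ` and top-codimension `tc` certifies α's conclusion as soon as `tc < n·(⌈n/ℓ⌉ − 1) − dim ker N_lin` (crit-7 V16
(a): the exact budget; «`ℓ·(tc + n) < n²`» is the slogan for `ℓ ∣ n`).  The research residue is the typed law `NilCoreLaw` (NOT asserted,
NOT a line): in the regime `C₀m² < n³` every IRREDUCIBLE affine nilpotent pencil has such a core.  CAUTION (crit-7 V16 (c), exact count):
the certificate is FALSE on GENERIC dense subspaces of `𝔫_m`; the law lives on «irreducible ⇒ far from generic» (corner isotropy / block
pairing — val-idea-26 g4 `Cruxes/…/SkewCorner.lean`, MEMO-g4: the skew-corner monoliths `W(T_p)` are NOT index-saturated; rank-one returns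
glue only over a totally corner-isotropic core, `SkewCorner.nilSpace_sup_span_vecMulVec_iff`).  DATA (MEMO-g3, exact mod p): every
census irreducible has a nil-core or torus-core with `tc ≤ 2`, class `≤ 4` (W₇/W₉: `tc = 1` by crit-7 V17's torus correction).

* `IsNilCore`, `coreFlag`, `coreFlag_zero`, `coreFlag_antitone`, `mulVec_mem_coreFlag_succ`, `coreFlag_eq_bot_of_isNilCore`;
* ★ `weightThin_of_nilCore`; `def NilCoreLaw` (NOT asserted); `weightThin_of_nilCoreLaw` (α's conclusion on the irreducible locus);
* `pow_eq_zero_of_isNilCore`, `indexCoreLaw_of_nilCoreLaw : NilCoreLaw → IndexCore.IndexCoreLaw` (✓ p670964's typed law).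

Honest framing.  Helper lemmas + one typed candidate law (`--supports stmt-ValiantsHypothesis-24318 --as helper`); nothing here asserts or
proves `NilCoreLaw`, S1b, C⁺, R2 `HeavyTopLaw`, the crux, 8062 or `VP ≠ VNP` — all OPEN / NOT proved.
[val-idea-26 g3, NilCore.lean §1–§2; MOR 1991 Lemma 2 + p.14; de Seguins Pazzis arXiv:1804.07938 Lemma 2.1; Radjavi–Rosenthal §1.4, §2.1]
-/

noncomputable section

-- single-conjunct layout: Sub = Summit, duplicated namespace component intended (the name is mandated)
set_option linter.dupNamespace false
set_option autoImplicit false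

namespace Summit.ValiantsHypothesis.ValiantsHypothesis.Theorems.GrenetZeon.NilCore

open MvPolynomial Matrix
open Summit.ValiantsHypothesis.ValiantsHypothesis.Cruxes.TwoDimCoefficients.DimTwoCases (AffMat IsAffine)
open Summit.ValiantsHypothesis.ValiantsHypothesis.Theorems.GrenetZeon.RadicalSplit
open Summit.ValiantsHypothesis.ValiantsHypothesis.Theorems.GrenetZeon.KrylovSeed
open Summit.ValiantsHypothesis.ValiantsHypothesis.Theorems.GrenetZeon.RadicalCoarsening
  (exists_adapted_basis conj_entry_eq_repr toMatrix'_equivFun_mul_symm toMatrix'_symm_mul_equivFun)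
open Summit.ValiantsHypothesis.ValiantsHypothesis.Theorems.GrenetZeon.IndexCore (IndexCoreLaw)

variable {m : ℕ}

/-- `T` is a NIL-CORE of class `≤ ℓ`: every product of `ℓ` members of `T` vanishes (so the associative algebra generated by
`T` is nilpotent of class `≤ ℓ`). [val-idea-26 g3] -/
def IsNilCore (T : Submodule ℂ (Matrix (Fin m) (Fin m) ℂ)) (ℓ : ℕ) : Prop :=
  ∀ f : Fin ℓ → Matrix (Fin m) (Fin m) ℂ, (∀ i, f i ∈ T) → (List.ofFn f).prod = 0

/-- The descending ORBIT CHAIN of `T`: `F_t = span {A₁ ⋯ A_t v : Aᵢ ∈ T, v ∈ ℂ^m}` (`F₀ = ℂ^m`). [val-idea-26 g3] -/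
def coreFlag (T : Submodule ℂ (Matrix (Fin m) (Fin m) ℂ)) (t : ℕ) : Submodule ℂ (Fin m → ℂ) :=
  Submodule.span ℂ {y | ∃ f : Fin t → Matrix (Fin m) (Fin m) ℂ, (∀ i, f i ∈ T) ∧ ∃ v, y = (List.ofFn f).prod *ᵥ v}

/-- `F₀ = ℂ^m`. [val-idea-26 g3] -/
theorem coreFlag_zero (T : Submodule ℂ (Matrix (Fin m) (Fin m) ℂ)) : coreFlag T 0 = ⊤ := by
  refine eq_top_iff.mpr fun y _ => Submodule.subset_span ?_
  exact ⟨Fin.elim0, fun i => i.elim0, y, by simp⟩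

/-- The orbit chain descends: `F_s ≤ F_t` for `t ≤ s`. [val-idea-26 g3] -/
theorem coreFlag_antitone (T : Submodule ℂ (Matrix (Fin m) (Fin m) ℂ)) : Antitone (coreFlag T) := by
  intro t s hts
  obtain ⟨k, rfl⟩ := Nat.exists_eq_add_of_le hts
  refine Submodule.span_le.mpr ?_
  rintro y ⟨f, hf, v, rfl⟩
  refine Submodule.subset_span ⟨fun i => f (Fin.castLE (Nat.le_add_right t k) i), fun i => hf _,
    (List.ofFn fun j => f (Fin.natAdd t j)).prod *ᵥ v, ?_⟩
  rw [List.ofFn_add, List.prod_append, Matrix.mulVec_mulVec]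

/-- Members of `T` map `F_t` into `F_{t+1}`. [val-idea-26 g3] -/
theorem mulVec_mem_coreFlag_succ (T : Submodule ℂ (Matrix (Fin m) (Fin m) ℂ)) {A : Matrix (Fin m) (Fin m) ℂ}
    (hA : A ∈ T) {t : ℕ} {y : Fin m → ℂ} (hy : y ∈ coreFlag T t) : A *ᵥ y ∈ coreFlag T (t + 1) := by
  have : coreFlag T t ≤ (coreFlag T (t + 1)).comap (Matrix.toLin' A) := by
    refine Submodule.span_le.mpr ?_
    rintro y ⟨f, hf, v, rfl⟩
    refine Submodule.subset_span ⟨Fin.cons A f, fun i => ?_, v, ?_⟩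
    · refine Fin.cases ?_ (fun j => ?_) i
      · simpa using hA
      · simpa using hf j
    · simp [Matrix.toLin'_apply, List.ofFn_succ, Matrix.mulVec_mulVec]
  exact this hy

/-- A nil-core of class `≤ ℓ` has `F_ℓ = 0`. [val-idea-26 g3] -/
theorem coreFlag_eq_bot_of_isNilCore (T : Submodule ℂ (Matrix (Fin m) (Fin m) ℂ)) {ℓ : ℕ} (hT : IsNilCore T ℓ) :
    coreFlag T ℓ = ⊥ := by
  refine (Submodule.span_eq_bot).mpr ?_
  rintro y ⟨f, hf, v, rfl⟩
  rw [hT f hf, Matrix.zero_mulVec]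

/-- ★ **NIL-CORES ARE WEIGHT CERTIFICATES** (first lemma of the card, PROVED).  If the tops `N_lin(v)`, `v ∈ K`, of an affine pencil lie
in a nil-core `T` of class `≤ ℓ` (`ℓ ≥ 1`) and `((ℓ−1)·n/ℓ + 1)·n < dim K`, the pencil is `WeightThin n m N`: levels = the orbit chain of
`T` (`p = ℓ`), climb `c = 1`, drop `r = ℓ − 1` (vacuous — no hypothesis on `N(x)` at all). [val-idea-26 g3] -/
theorem weightThin_of_nilCore {n : ℕ} (N : AffMat n m)
    (T : Submodule ℂ (Matrix (Fin m) (Fin m) ℂ)) (ℓ : ℕ) (hℓ : 1 ≤ ℓ) (hT : IsNilCore T ℓ)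
    (K : Submodule ℂ (Fin n × Fin n → ℂ)) (hK : ∀ v ∈ K, linPart N v ∈ T)
    (hdim : ((ℓ - 1) * n / ℓ + 1) * n < Module.finrank ℂ K) :
    WeightThin n m N := by
  classical
  have hanti := coreFlag_antitone T
  obtain ⟨b, lvl, hbmem, hlvl, key, -⟩ :=
    exists_adapted_basis (coreFlag T) hanti (coreFlag_zero T) (coreFlag_eq_bot_of_isNilCore T hT)
  let Pm : Matrix (Fin m) (Fin m) ℂ := LinearMap.toMatrix' (b.equivFun : (Fin m → ℂ) →ₗ[ℂ] (Fin m → ℂ))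
  let Qm : Matrix (Fin m) (Fin m) ℂ := LinearMap.toMatrix' (b.equivFun.symm : (Fin m → ℂ) →ₗ[ℂ] (Fin m → ℂ))
  let P : (Matrix (Fin m) (Fin m) ℂ)ˣ := ⟨Pm, Qm, toMatrix'_equivFun_mul_symm b, toMatrix'_symm_mul_equivFun b⟩
  have hentry : ∀ (A : Matrix (Fin m) (Fin m) ℂ) (i j : Fin m), (Pm * A * Qm) i j = b.repr (A *ᵥ b j) i :=
    fun A i j => conj_entry_eq_repr b A i j
  refine ⟨P, lvl, ℓ, ℓ - 1, 1, K, le_rfl, hlvl, ?_, ?_, ?_⟩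
  · -- drop `r = ℓ − 1`: vacuous, all levels lie in `[0, ℓ)`
    intro i j hij
    exact absurd hij (by have := hlvl j; omega)
  · -- climb `c = 1`: a top in `T` maps `F_t` into `F_{t+1}`
    intro v hv i j hij
    show (Pm * linPart N v * Qm) i j = 0
    rw [hentry]
    by_contra hne
    have hy : linPart N v *ᵥ b j ∈ coreFlag T (lvl j + 1) := mulVec_mem_coreFlag_succ T (hK v hv) (hbmem j)
    have := key (lvl j + 1) _ hy i hne
    omega
  · -- budget: `(ℓ−1 + (ℓ−1)(n−1))/(1+(ℓ−1)) = (ℓ−1)n/ℓ` for `n ≥ 1`; both sides vanish for `n = 0`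
    rcases Nat.eq_zero_or_pos n with rfl | hn
    · simpa using hdim
    · obtain ⟨k, rfl⟩ := Nat.exists_eq_add_of_le hn
      have h1 : ℓ - 1 + (ℓ - 1) * (1 + k - 1) = (ℓ - 1) * (1 + k) := by
        rw [Nat.add_sub_cancel_left]; ring
      have h2 : 1 + (ℓ - 1) = ℓ := Nat.add_sub_of_le hℓ
      rw [h1, h2]
      exact hdim

/-- **`NilCoreLaw`** — the card's research residue (a CANDIDATE law, NOT asserted): in the regime `C₀·m² < n³` every IRREDUCIBLE affine
nilpotent pencil (`𝒜(N) = M_m`; irreducible pencils are heavy-top, radical_split.md D1) has a nil-core `T ∋ N_lin(K)` of class `ℓ` with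
`((ℓ−1)n/ℓ + 1)·n < dim K` — informally `ℓ·(tc + n) < n²`, `tc = codim N_lin⁻¹(T)`.  With ★ it gives `WeightThin` on the irreducible
locus of S1b (`FatBlockWeightLaw` ≡ C⁺, `Lines/krylov_seed.lean` rev 4); the reducible fat-block case is glued by the line's S1a/S1c.  CAUTION
(crit-7 g2 V16 (c), exact count): the certificate is FALSE on GENERIC dense subspaces of `𝔫_m` — the law is conjectured ONLY on the
irreducible locus `pencilAlg N = ⊤` and rests on «irreducible ⇒ far from generic»; NOT asserted, NOT a line of record. [val-idea-26 g3] -/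
def NilCoreLaw : Prop :=
  ∃ C₀ n₀ : ℕ, ∀ n ≥ n₀, ∀ m : ℕ, C₀ * m ^ 2 < n ^ 3 → ∀ N : AffMat n m, IsAffine N → N ^ m = 0 → pencilAlg N = ⊤ →
    ∃ (T : Submodule ℂ (Matrix (Fin m) (Fin m) ℂ)) (ℓ : ℕ) (K : Submodule ℂ (Fin n × Fin n → ℂ)),
      1 ≤ ℓ ∧ IsNilCore T ℓ ∧ (∀ v ∈ K, linPart N v ∈ T) ∧ ((ℓ - 1) * n / ℓ + 1) * n < Module.finrank ℂ K

/-- The law closes the irreducible locus (one line from ★). [val-idea-26 g3] -/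
theorem weightThin_of_nilCoreLaw (h : NilCoreLaw) :
    ∃ C₀ n₀ : ℕ, ∀ n ≥ n₀, ∀ m : ℕ, C₀ * m ^ 2 < n ^ 3 → ∀ N : AffMat n m, IsAffine N → N ^ m = 0 → pencilAlg N = ⊤ →
      WeightThin n m N := by
  obtain ⟨C₀, n₀, h⟩ := h
  refine ⟨C₀, n₀, fun n hn m hm N hN hnil hirr => ?_⟩
  obtain ⟨T, ℓ, K, hℓ, hT, hK, hdim⟩ := h n hn m hm N hN hnil hirr
  exact weightThin_of_nilCore N T ℓ hℓ hT K hK hdim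

/-! ## §3 Bridges to the index-core block (✓ p670964 `…HeavyTopIndexCore`) -/

/-- A nil-core of class `ℓ` is in particular an index-core of index `ℓ`. -/
theorem pow_eq_zero_of_isNilCore {T : Submodule ℂ (Matrix (Fin m) (Fin m) ℂ)} {ℓ : ℕ} (hT : IsNilCore T ℓ)
    {Q : Matrix (Fin m) (Fin m) ℂ} (hQ : Q ∈ T) : Q ^ ℓ = 0 := by
  have := hT (fun _ => Q) (fun _ => hQ)
  rwa [List.ofFn_const, List.prod_replicate] at this

/-- `NilCoreLaw ⇒ IndexCoreLaw` (✓ p670964's typed law; elementwise index `≤ ℓ` from joint class `≤ ℓ`). [val-idea-26 g3] -/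
theorem indexCoreLaw_of_nilCoreLaw (h : NilCoreLaw) : IndexCoreLaw := by
  obtain ⟨C₀, n₀, h⟩ := h
  refine ⟨C₀, n₀, fun n hn m' hm N hN hnil hirr => ?_⟩
  obtain ⟨T, ℓ, K, hℓ, hT, hK, hdim⟩ := h n hn m' hm N hN hnil hirr
  exact ⟨T, ℓ, K, hℓ, fun Q hQ => pow_eq_zero_of_isNilCore hT hQ, hK, hdim⟩

end Summit.ValiantsHypothesis.ValiantsHypothesis.Theorems.GrenetZeon.NilCore

end
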